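import Literature.Probability.Distributions.StdGaussianDensity
import Mathlib.MeasureTheory.Constructions.HaarToSphere
import Mathlib.MeasureTheory.Function.JacobianOneDim
import Mathlib.Probability.Distributions.Gamma
import HarnessLib

/-!
# The squared norm of a standard Gaussian vector and the sphere marginal

`Literature/Probability/Distributions/`. Two classical laws attached to the standard Gaussian
measure `ProbabilityTheory.stdGaussian F` of a finite-dimensional real inner product space `F`
of dimension `d ≥ 1`:

* `map_norm_sq_stdGaussian` — the law of `‖x‖²` is the `χ²_d` law, in Mathlib's vocabulary
  `gammaMeasure (d/2) (1/2)` (density `gammaPDFReal (d/2) (1/2) t = (1/2)^{d/2}/Γ(d/2) ·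
  t^{d/2-1} e^{-t/2}` on `t ≥ 0`). The computation (`lintegral_comp_norm_sq_stdGaussian`) goes
  through polar coordinates (`lintegral_fun_norm_addHaar`, the `ℝ≥0∞` form of Mathlib's
  `integral_fun_norm_addHaar`) and the substitution `t = y²`, and produces the density in the
  closed form `normSqDensity F t = κ_F t^{d/2-1} e^{-t/2}` with `κ_F = d·vol(B₁)·(2π)^{-d/2}/2`
  (`normSqConst`); these two auxiliary definitions are identified with Mathlib's
  (`normSqConst_eq : κ_F = (1/2)^{d/2}/Γ(d/2)`, `normSqDensity_eq_gammaPDFReal`) by comparing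
  total masses, so no ball volume or Gamma integral is evaluated.
* `map_sphereMarginalMap_prod_stdGaussian` — for independent standard Gaussians `x` on `E₁` and
  `y` on `F`, the law of `x / √(‖x‖² + ‖y‖²)` (the `E₁`-block of the uniformly distributed unit
  vector `(x, y)/‖(x, y)‖` of `E₁ ⊕ F`) is `K (1 - ‖b‖²)^{d/2 - 1} 𝟙_{‖b‖ < 1} db` on `E₁` for a
  constant `K > 0` (`sphereMarginalDensity`): shift `‖y‖² ↦ s = ‖x‖² + ‖y‖²`, where the Gaussian
  weights combine to `e^{-s/2}`, then rescale `x = √s · b`; the joint density factorises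
  (`sphereFibre`, `sphereWeight` are the auxiliary integrands of this computation).

These are the "beta" laws of sub-vectors of a uniform point on a sphere (for complex spaces,
`d = 2r`, the exponent is the integer `r - 1`); they are the one-column case of the law of
truncations of Haar unitary / orthogonal matrices. All [folklore] (e.g. Muirhead, *Aspects of
multivariate statistical theory*, Thm. 1.5.7 (ii); Życzkowski–Sommers, J. Phys. A 33 (2000)
2045–2057, eq. (19)).
-/

noncomputable section

open MeasureTheory ProbabilityTheory Set Real Metric Module
open scoped ENNReal

namespace Literature.Probability.Distributions

/-! ### Polar coordinates for lower integrals -/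

section Polar

variable {E : Type*} [NormedAddCommGroup E] [NormedSpace ℝ E] [MeasurableSpace E] [BorelSpace E]
  [FiniteDimensional ℝ E] [Nontrivial E] (μ : Measure E) [μ.IsAddHaarMeasure]

/-- **Integration of a radial function in polar coordinates**, `ℝ≥0∞` form of Mathlib's
`MeasureTheory.integral_fun_norm_addHaar`:
`∫⁻ f(‖x‖) dμ = d · μ(B₁) · ∫⁻_{y > 0} y^{d-1} f(y) dy`. [folklore] -/
theorem lintegral_fun_norm_addHaar (f : ℝ → ℝ≥0∞) (hf : Measurable f) :
    ∫⁻ x, f ‖x‖ ∂μ =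
      finrank ℝ E * μ (ball 0 1) *
        ∫⁻ y in Ioi (0 : ℝ), ENNReal.ofReal (y ^ (finrank ℝ E - 1)) * f y := by
  have hmeas : Measurable fun x : ↥(sphere (0 : E) 1) × ↥(Ioi (0 : ℝ)) => f x.2.1 :=
    hf.comp (measurable_subtype_coe.comp measurable_snd)
  calc ∫⁻ x, f ‖x‖ ∂μ = ∫⁻ x : ({(0 : E)}ᶜ : Set E), f ‖(x : E)‖ ∂(μ.comap (↑)) := by
        rw [lintegral_subtype_comap (measurableSet_singleton _).compl (fun x => f ‖x‖),
          restrict_compl_singleton]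
    _ = ∫⁻ x, f x.2.1 ∂(μ.toSphere.prod (Measure.volumeIoiPow (finrank ℝ E - 1))) := by
        rw [← (μ.measurePreserving_homeomorphUnitSphereProd).lintegral_comp_emb
          (Homeomorph.measurableEmbedding _)]
        simp only [homeomorphUnitSphereProd_apply_snd_coe]
    _ = μ.toSphere univ * ∫⁻ r, f r.1 ∂(Measure.volumeIoiPow (finrank ℝ E - 1)) := by
        rw [lintegral_prod _ hmeas.aemeasurable]
        simp only [lintegral_const, mul_comm]
    _ = finrank ℝ E * μ (ball 0 1) *
          ∫⁻ y in Ioi (0 : ℝ), ENNReal.ofReal (y ^ (finrank ℝ E - 1)) * f y := by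
        have hm1 : Measurable fun r : ↥(Ioi (0 : ℝ)) =>
            ENNReal.ofReal ((r : ℝ) ^ (finrank ℝ E - 1)) :=
          ENNReal.measurable_ofReal.comp (measurable_subtype_coe.pow_const _)
        have hm2 : Measurable fun r : ↥(Ioi (0 : ℝ)) => f (r : ℝ) := hf.comp measurable_subtype_coe
        have key : ∫⁻ r, f r.1 ∂(Measure.volumeIoiPow (finrank ℝ E - 1)) =
            ∫⁻ y in Ioi (0 : ℝ), ENNReal.ofReal (y ^ (finrank ℝ E - 1)) * f y := by
          rw [Measure.volumeIoiPow, lintegral_withDensity_eq_lintegral_mul _ hm1 hm2,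
            ← lintegral_subtype_comap measurableSet_Ioi
              (fun y => ENNReal.ofReal (y ^ (finrank ℝ E - 1)) * f y)]
          rfl
        rw [Measure.toSphere_apply_univ, key]

end Polar

/-! ### The law of `‖x‖²` under the standard Gaussian -/

section NormSq

variable (F : Type*) [NormedAddCommGroup F] [InnerProductSpace ℝ F] [FiniteDimensional ℝ F]
  [MeasurableSpace F] [BorelSpace F]

/-- Auxiliary closed form of the normalising constant of the `χ²_d` density of `‖x‖²`,
`x ∼ stdGaussian F`, `d = dim F`, as it comes out of polar coordinates:
`κ_F = d · vol(B₁) · (2π)^{-d/2} / 2`. It equals Mathlib's `(1/2)^{d/2} / Γ(d/2)`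
(`normSqConst_eq`). [folklore] -/
def normSqConst : ℝ :=
  finrank ℝ F * (volume : Measure F).real (ball 0 1) *
    (2 * π) ^ (-(finrank ℝ F : ℝ) / 2) / 2

/-- Auxiliary closed form `κ_F t^{d/2 - 1} e^{-t/2}` of the `χ²_d` density of `‖x‖²` for
`x ∼ stdGaussian F` (meaningful for `t > 0`); it is Mathlib's `gammaPDFReal (d/2) (1/2)` on
`t ≥ 0` (`normSqDensity_eq_gammaPDFReal`). [folklore] -/
def normSqDensity (t : ℝ) : ℝ :=
  normSqConst F * (t ^ ((finrank ℝ F : ℝ) / 2 - 1) * rexp (-t / 2))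

variable {F}

/-- `κ_F ≥ 0`. [folklore] -/
theorem normSqConst_nonneg : 0 ≤ normSqConst F := by
  unfold normSqConst; positivity

/-- The `χ²` density is nonnegative on `[0, ∞)`. [folklore] -/
theorem normSqDensity_nonneg {t : ℝ} (ht : 0 ≤ t) : 0 ≤ normSqDensity F t := by
  unfold normSqDensity
  exact mul_nonneg normSqConst_nonneg (mul_nonneg (rpow_nonneg ht _) (exp_pos _).le)

/-- The `χ²` density is measurable. [folklore] -/
@[fun_prop]
theorem measurable_normSqDensity : Measurable (normSqDensity F) := by
  unfold normSqDensity
  refine measurable_const.mul ((Measurable.pow_const measurable_id _).mul ?_)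
  fun_prop

/-- **The law of `‖x‖²` under the standard Gaussian**, `ℝ≥0∞` transfer form (auxiliary
closed-form density): for measurable `G ≥ 0`,
`∫⁻ G(‖x‖²) dγ_F(x) = ∫⁻_{t>0} G(t) κ_F t^{d/2-1} e^{-t/2} dt` (`d = dim F ≥ 1`). Polar
coordinates and the substitution `t = y²`. [folklore] -/
theorem lintegral_comp_norm_sq_stdGaussian [Nontrivial F] (G : ℝ → ℝ≥0∞) (hG : Measurable G) :
    ∫⁻ x, G (‖x‖ ^ 2) ∂(stdGaussian F) =
      ∫⁻ t in Ioi (0 : ℝ), G t * ENNReal.ofReal (normSqDensity F t) := by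
  set d : ℕ := finrank ℝ F with hd
  set c : ℝ := (2 * π) ^ (-(d : ℝ) / 2) with hc
  have hc0 : 0 < c := rpow_pos_of_pos (by positivity) _
  have hd1 : 1 ≤ d := Nat.one_le_iff_ne_zero.2 (finrank_pos (R := ℝ) (M := F)).ne'
  -- the Gaussian side in polar coordinates
  have hGn : Measurable fun v : F => G (‖v‖ ^ 2) := hG.comp (by fun_prop)
  set Φ : ℝ → ℝ≥0∞ := fun y => ENNReal.ofReal (c * rexp (-y ^ 2 / 2)) * G (y ^ 2) with hΦ
  have hΦm : Measurable Φ := by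
    refine Measurable.mul (ENNReal.measurable_ofReal.comp ?_) (hG.comp (measurable_id.pow_const 2))
    fun_prop
  have h1 : ∫⁻ x, G (‖x‖ ^ 2) ∂(stdGaussian F) = ∫⁻ x, Φ ‖x‖ ∂(volume : Measure F) := by
    rw [lintegral_stdGaussian_eq_lintegral_mul hGn]
  rw [h1, lintegral_fun_norm_addHaar volume Φ hΦm]
  -- the right-hand side by the substitution `t = y²`
  have hderiv : ∀ y ∈ Ioi (0 : ℝ), HasDerivWithinAt (fun y : ℝ => y ^ 2) (2 * y) (Ioi 0) y := by
    intro y _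
    simpa using (hasDerivAt_pow 2 y).hasDerivWithinAt
  have hinj : InjOn (fun y : ℝ => y ^ 2) (Ioi 0) := by
    intro a ha b hb hab
    exact (sq_eq_sq₀ (le_of_lt (α := ℝ) ha) (le_of_lt (α := ℝ) hb)).1 hab
  have himage : (fun y : ℝ => y ^ 2) '' Ioi 0 = Ioi 0 := by
    ext t
    constructor
    · rintro ⟨y, hy, rfl⟩; exact pow_pos (mem_Ioi.1 hy) 2
    · intro ht
      exact ⟨√t, Real.sqrt_pos.2 ht, Real.sq_sqrt (le_of_lt (α := ℝ) ht)⟩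
  have h2 := lintegral_image_eq_lintegral_abs_deriv_mul measurableSet_Ioi hderiv hinj
    (fun t => G t * ENNReal.ofReal (normSqDensity F t))
  rw [himage] at h2
  have hm : Measurable fun y : ℝ => ENNReal.ofReal (y ^ (finrank ℝ F - 1)) * Φ y :=
    (ENNReal.measurable_ofReal.comp (measurable_id.pow_const _)).mul hΦm
  rw [h2, ← lintegral_const_mul _ hm]
  refine setLIntegral_congr_fun measurableSet_Ioi fun y hy => ?_
  have hy0 : (0 : ℝ) < y := hy
  -- compare the two integrands at `y > 0`
  have hvol : (volume : Measure F) (ball 0 1) =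
      ENNReal.ofReal ((volume : Measure F).real (ball 0 1)) :=
    (ENNReal.ofReal_toReal measure_ball_lt_top.ne).symm
  have hpow : (y ^ 2) ^ ((d : ℝ) / 2 - 1) = y ^ ((d : ℝ) - 2) := by
    rw [← Real.rpow_natCast y 2, ← Real.rpow_mul hy0.le]
    congr 1; push_cast; ring
  have hpow' : y * y ^ ((d : ℝ) - 2) = y ^ (d - 1) := by
    rw [← Real.rpow_natCast y (d - 1), Nat.cast_sub hd1, Nat.cast_one,
      show (d : ℝ) - 1 = 1 + ((d : ℝ) - 2) by ring, Real.rpow_add hy0, Real.rpow_one]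
  rw [hΦ]
  dsimp only
  rw [hvol, abs_of_pos (by positivity : (0 : ℝ) < 2 * y), normSqDensity, normSqConst, ← hd, ← hc,
    hpow]
  -- everything is a product of `G (y²)` with nonnegative reals
  have hA : (0 : ℝ) ≤ y ^ (d - 1) := pow_nonneg hy0.le _
  symm
  calc ENNReal.ofReal (2 * y) * (G (y ^ 2) * ENNReal.ofReal
        ((d : ℝ) * (volume : Measure F).real (ball 0 1) * c / 2 *
          (y ^ ((d : ℝ) - 2) * rexp (-(y ^ 2) / 2))))
      = G (y ^ 2) * ENNReal.ofReal (2 * y * ((d : ℝ) * (volume : Measure F).real (ball 0 1) *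
          c / 2 * (y ^ ((d : ℝ) - 2) * rexp (-(y ^ 2) / 2)))) := by
        rw [mul_left_comm, ← ENNReal.ofReal_mul (by positivity)]
    _ = G (y ^ 2) * ENNReal.ofReal ((d : ℝ) * (volume : Measure F).real (ball 0 1) *
          (y ^ (d - 1) * (c * rexp (-y ^ 2 / 2)))) := by
        congr 2
        rw [← hpow']
        ring
    _ = (d : ℝ≥0∞) * ENNReal.ofReal ((volume : Measure F).real (ball 0 1)) *
          (ENNReal.ofReal (y ^ (d - 1)) * (ENNReal.ofReal (c * rexp (-y ^ 2 / 2)) * G (y ^ 2))) := by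
        rw [ENNReal.ofReal_mul (by positivity), ENNReal.ofReal_mul (by positivity),
          ENNReal.ofReal_mul hA, ENNReal.ofReal_natCast]
        ring

/-- The push-forward of `stdGaussian F` along `x ↦ ‖x‖²`, with the auxiliary closed-form
density. [folklore] -/
theorem map_norm_sq_stdGaussian_eq_withDensity [Nontrivial F] :
    (stdGaussian F).map (fun x => ‖x‖ ^ 2) =
      (volume.restrict (Ioi (0 : ℝ))).withDensity fun t => ENNReal.ofReal (normSqDensity F t) := by
  refine Measure.ext_of_lintegral _ fun G hG => ?_
  rw [lintegral_map hG (by fun_prop), lintegral_comp_norm_sq_stdGaussian G hG,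
    lintegral_withDensity_eq_lintegral_mul _ (by fun_prop) hG]
  refine setLIntegral_congr_fun measurableSet_Ioi fun t _ => ?_
  simp only [Pi.mul_apply, mul_comm]

/-- Mathlib's `gammaMeasure a (1/2)` written as a density on `(0, ∞)`:
`(1/2)^a/Γ(a) · t^{a-1} e^{-t/2} 𝟙_{t>0} dt` (the density vanishes on `t < 0` and `{0}` is
null). [folklore] -/
theorem gammaMeasure_half_eq_restrict_withDensity (a : ℝ) :
    gammaMeasure a (1 / 2) = (volume.restrict (Ioi (0 : ℝ))).withDensity fun t =>
      ENNReal.ofReal ((1 / 2 : ℝ) ^ a / Real.Gamma a * (t ^ (a - 1) * rexp (-t / 2))) := by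
  have hfun : gammaPDF a (1 / 2) = (Ici (0 : ℝ)).indicator fun t =>
      ENNReal.ofReal ((1 / 2 : ℝ) ^ a / Real.Gamma a * (t ^ (a - 1) * rexp (-t / 2))) := by
    funext t
    by_cases ht : 0 ≤ t
    · rw [gammaPDF_of_nonneg ht, indicator_of_mem (mem_Ici.2 ht)]
      congr 1
      rw [mul_assoc]
      congr 2
      ring_nf
    · rw [gammaPDF_of_neg (not_le.1 ht), indicator_of_notMem (fun h => ht (mem_Ici.1 h))]
  rw [gammaMeasure, hfun, withDensity_indicator measurableSet_Ici,
    Measure.restrict_congr_set Ioi_ae_eq_Ici.symm]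

/-- **The law of `‖x‖²` under the standard Gaussian is `χ²_d`**: in Mathlib's vocabulary,
`(stdGaussian F).map (‖·‖²) = gammaMeasure (d/2) (1/2)`, `d = dim F ≥ 1`. Both sides are
probability measures with densities proportional to `t^{d/2-1} e^{-t/2} 𝟙_{t>0}`
(`map_norm_sq_stdGaussian_eq_withDensity`, `gammaMeasure_half_eq_restrict_withDensity`), hence
equal; this also identifies the constants (`normSqConst_eq`). [folklore] -/
theorem map_norm_sq_stdGaussian [Nontrivial F] :
    (stdGaussian F).map (fun x => ‖x‖ ^ 2) = gammaMeasure ((finrank ℝ F : ℝ) / 2) (1 / 2) ∧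
      normSqConst F = (1 / 2 : ℝ) ^ ((finrank ℝ F : ℝ) / 2) / Real.Gamma ((finrank ℝ F : ℝ) / 2) := by
  set a : ℝ := (finrank ℝ F : ℝ) / 2 with ha
  have ha0 : 0 < a := by
    rw [ha]; exact div_pos (Nat.cast_pos.2 (finrank_pos (R := ℝ) (M := F))) two_pos
  set cg : ℝ := (1 / 2 : ℝ) ^ a / Real.Gamma a with hcg
  have hcg0 : 0 ≤ cg := div_nonneg (rpow_nonneg (by norm_num) _) (Real.Gamma_pos_of_pos ha0).le
  have hκ0 : 0 ≤ normSqConst F := normSqConst_nonneg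
  set ψ : ℝ → ℝ≥0∞ := fun t => ENNReal.ofReal (t ^ (a - 1) * rexp (-t / 2)) with hψ
  have hψm : Measurable ψ := by
    refine ENNReal.measurable_ofReal.comp ((Measurable.pow_const measurable_id _).mul ?_)
    fun_prop
  set ν₀ : Measure ℝ := (volume.restrict (Ioi (0 : ℝ))).withDensity ψ with hν₀
  -- both measures are constant multiples of `ν₀`
  have h1 : (stdGaussian F).map (fun x => ‖x‖ ^ 2) = ENNReal.ofReal (normSqConst F) • ν₀ := by
    rw [map_norm_sq_stdGaussian_eq_withDensity, hν₀, ← withDensity_smul _ hψm]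
    congr 1
    funext t
    rw [Pi.smul_apply, smul_eq_mul, normSqDensity, ← ha, ENNReal.ofReal_mul hκ0]
  have h2 : gammaMeasure a (1 / 2) = ENNReal.ofReal cg • ν₀ := by
    rw [gammaMeasure_half_eq_restrict_withDensity, hν₀, ← withDensity_smul _ hψm]
    congr 1
    funext t
    rw [Pi.smul_apply, smul_eq_mul, ← hcg, ENNReal.ofReal_mul hcg0]
  -- compare total masses
  haveI : IsProbabilityMeasure (gammaMeasure a (1 / 2)) :=
    isProbabilityMeasure_gammaMeasure ha0 (by norm_num)
  haveI : IsProbabilityMeasure ((stdGaussian F).map fun x => ‖x‖ ^ 2) :=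
    Measure.isProbabilityMeasure_map (by fun_prop)
  have m1 : ENNReal.ofReal (normSqConst F) * ν₀ univ = 1 := by
    have := congrArg (fun μ : Measure ℝ => μ univ) h1
    simpa only [measure_univ, Measure.smul_apply, smul_eq_mul] using this.symm
  have m2 : ENNReal.ofReal cg * ν₀ univ = 1 := by
    have := congrArg (fun μ : Measure ℝ => μ univ) h2
    simpa only [measure_univ, Measure.smul_apply, smul_eq_mul] using this.symm
  have hM0 : ν₀ univ ≠ 0 := fun h0 => by simp [h0] at m1
  have hMtop : ν₀ univ ≠ ⊤ := by
    intro htop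
    rw [htop, ENNReal.mul_top'] at m1
    split_ifs at m1 <;> simp at m1
  have hconst : ENNReal.ofReal (normSqConst F) = ENNReal.ofReal cg := by
    rw [← m2] at m1
    exact (ENNReal.mul_left_inj hM0 hMtop).1 m1
  refine ⟨by rw [h1, h2, hconst], ?_⟩
  exact (ENNReal.ofReal_eq_ofReal_iff hκ0 hcg0).1 hconst

/-- **The constant**: `κ_F = d · vol(B₁) · (2π)^{-d/2} / 2 = (1/2)^{d/2} / Γ(d/2)` (equivalently
`vol(B₁) = π^{d/2}/Γ(d/2 + 1)`), obtained here by comparing total masses. [folklore] -/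
theorem normSqConst_eq [Nontrivial F] :
    normSqConst F = (1 / 2 : ℝ) ^ ((finrank ℝ F : ℝ) / 2) / Real.Gamma ((finrank ℝ F : ℝ) / 2) :=
  map_norm_sq_stdGaussian.2

/-- The auxiliary density is Mathlib's `χ²_d = Gamma(d/2, 1/2)` density on `t ≥ 0`. [folklore] -/
theorem normSqDensity_eq_gammaPDFReal [Nontrivial F] {t : ℝ} (ht : 0 ≤ t) :
    normSqDensity F t = gammaPDFReal ((finrank ℝ F : ℝ) / 2) (1 / 2) t := by
  rw [normSqDensity, normSqConst_eq, gammaPDFReal, if_pos ht, mul_assoc]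
  congr 2
  ring_nf

end NormSq

/-! ### The sphere marginal -/

section SphereMarginal

variable {E₁ : Type*} [NormedAddCommGroup E₁] [InnerProductSpace ℝ E₁] [FiniteDimensional ℝ E₁]
  [MeasurableSpace E₁] [BorelSpace E₁]
variable {F : Type*} [NormedAddCommGroup F] [InnerProductSpace ℝ F] [FiniteDimensional ℝ F]
  [MeasurableSpace F] [BorelSpace F]

/-- Scaling of Lebesgue measure under dilations, lower-integral form:
`∫⁻ g(t • x) dx = |t|^{-d} ∫⁻ g` for `t ≠ 0`. [folklore] -/
theorem lintegral_comp_smul (g : E₁ → ℝ≥0∞) {t : ℝ} (ht : t ≠ 0) :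
    ∫⁻ x, g (t • x) = ENNReal.ofReal |(t ^ finrank ℝ E₁)⁻¹| * ∫⁻ y, g y := by
  calc ∫⁻ x, g (t • x) = ∫⁻ y, g y ∂(Measure.map (fun x : E₁ => t • x) volume) :=
        (lintegral_map_equiv g
          (Homeomorph.smul (isUnit_iff_ne_zero.2 ht).unit).toMeasurableEquiv).symm
    _ = ENNReal.ofReal |(t ^ finrank ℝ E₁)⁻¹| * ∫⁻ y, g y := by
        rw [Measure.map_addHaar_smul volume ht, lintegral_smul_measure, smul_eq_mul]

/-- Translation on a half-line: `∫⁻_{t > 0} f(a + t) dt = ∫⁻_{s > a} f(s) ds`. [folklore] -/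
theorem lintegral_Ioi_comp_const_add (f : ℝ → ℝ≥0∞) (a : ℝ) :
    ∫⁻ t in Ioi (0 : ℝ), f (a + t) = ∫⁻ s in Ioi a, f s := by
  rw [← lintegral_indicator measurableSet_Ioi, ← lintegral_indicator measurableSet_Ioi,
    ← lintegral_sub_right_eq_self (fun t => (Ioi (0 : ℝ)).indicator (fun t => f (a + t)) t) a]
  refine lintegral_congr fun s => ?_
  by_cases hs : s ∈ Ioi a
  · have hs' : s - a ∈ Ioi (0 : ℝ) := mem_Ioi.2 (sub_pos.2 (mem_Ioi.1 hs))
    rw [indicator_of_mem hs', indicator_of_mem hs, add_sub_cancel]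
  · have hs' : s - a ∉ Ioi (0 : ℝ) := fun h => hs (mem_Ioi.2 (sub_pos.1 (mem_Ioi.1 h)))
    rw [indicator_of_notMem hs', indicator_of_notMem hs]

variable (E₁ F) in
/-- The `E₁`-block of the normalised vector `(x, y)/‖(x, y)‖` of `E₁ ⊕ F`:
`(x, y) ↦ x / √(‖x‖² + ‖y‖²)` (junk value `0` at the origin, by `0⁻¹ = 0`). [folklore] -/
def sphereMarginalMap (p : E₁ × F) : E₁ :=
  (√(‖p.1‖ ^ 2 + ‖p.2‖ ^ 2))⁻¹ • p.1

/-- The (un-normalised) density `(1 - ‖b‖²)^{d/2 - 1} 𝟙_{‖b‖ < 1}` on `E₁` of the `E₁`-block of a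
uniform point on the unit sphere of `E₁ ⊕ F`, `d = dim F`. [folklore] -/
def sphereMarginalDensity (d : ℕ) (b : E₁) : ℝ :=
  if ‖b‖ < 1 then (1 - ‖b‖ ^ 2) ^ ((d : ℝ) / 2 - 1) else 0

omit [InnerProductSpace ℝ F] [FiniteDimensional ℝ F] in
/-- `sphereMarginalMap` is measurable. [folklore] -/
@[fun_prop]
theorem measurable_sphereMarginalMap : Measurable (sphereMarginalMap E₁ F) := by
  unfold sphereMarginalMap; fun_prop

omit [InnerProductSpace ℝ E₁] [FiniteDimensional ℝ E₁] [MeasurableSpace E₁] [BorelSpace E₁] in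
/-- The sphere-marginal density is nonnegative. [folklore] -/
theorem sphereMarginalDensity_nonneg (d : ℕ) (b : E₁) : 0 ≤ sphereMarginalDensity d b := by
  unfold sphereMarginalDensity
  split_ifs with h
  · refine rpow_nonneg ?_ _
    have : ‖b‖ ^ 2 < 1 := by
      have h0 := norm_nonneg b
      nlinarith
    linarith
  · exact le_rfl

omit [InnerProductSpace ℝ E₁] [FiniteDimensional ℝ E₁] in
/-- The sphere-marginal density is measurable. [folklore] -/
@[fun_prop]
theorem measurable_sphereMarginalDensity (d : ℕ) :
    Measurable (sphereMarginalDensity (E₁ := E₁) d) := by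
  unfold sphereMarginalDensity
  refine Measurable.ite (measurableSet_lt (by fun_prop) measurable_const) ?_ measurable_const
  exact (measurable_const.sub (measurable_norm.pow_const 2)).pow_const _

/-- Auxiliary (proof-side) integrand of the sphere-marginal computation, on the `s`-fibre: for
fixed `x ∈ E₁`, `s ↦ 𝟙_{‖x‖² < s} φ(x/√s) ψ_F(s - ‖x‖²)`. [folklore] -/
def sphereFibre (φ : E₁ → ℝ≥0∞) (x : E₁) (s : ℝ) : ℝ≥0∞ :=
  if ‖x‖ ^ 2 < s then φ ((√s)⁻¹ • x) * ENNReal.ofReal (normSqDensity F (s - ‖x‖ ^ 2)) else 0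

omit [FiniteDimensional ℝ E₁] in
/-- Joint measurability of the fibre integrand. [folklore] -/
theorem measurable_sphereFibre {φ : E₁ → ℝ≥0∞} (hφ : Measurable φ) :
    Measurable (Function.uncurry (sphereFibre (F := F) φ)) := by
  unfold sphereFibre Function.uncurry
  refine Measurable.ite ?_ ?_ measurable_const
  · exact measurableSet_lt (by fun_prop) (by fun_prop)
  · refine (hφ.comp ?_).mul (ENNReal.measurable_ofReal.comp
      (measurable_normSqDensity.comp (by fun_prop)))
    fun_prop

omit [FiniteDimensional ℝ E₁] in
/-- **Inner integral.** For fixed `x ∈ E₁`, integrating out the Gaussian `y ∈ F` through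
`t = ‖y‖²` (`lintegral_comp_norm_sq_stdGaussian`) and shifting `s = ‖x‖² + t`:
`∫⁻ φ(x/√(‖x‖² + ‖y‖²)) dγ_F(y) = ∫⁻_{s>0} 𝟙_{‖x‖² < s} φ(x/√s) ψ_F(s - ‖x‖²) ds`. [folklore] -/
theorem lintegral_sphereMarginalMap_fibre [Nontrivial F] {φ : E₁ → ℝ≥0∞} (hφ : Measurable φ)
    (x : E₁) :
    ∫⁻ y, φ (sphereMarginalMap E₁ F (x, y)) ∂(stdGaussian F) =
      ∫⁻ s in Ioi (0 : ℝ), sphereFibre (F := F) φ x s := by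
  have hG : Measurable fun t : ℝ => φ ((√(‖x‖ ^ 2 + t))⁻¹ • x) := hφ.comp (by fun_prop)
  have h1 := lintegral_comp_norm_sq_stdGaussian (F := F) _ hG
  simp only [sphereMarginalMap]
  rw [h1]
  set f : ℝ → ℝ≥0∞ := fun s => φ ((√s)⁻¹ • x) * ENNReal.ofReal (normSqDensity F (s - ‖x‖ ^ 2))
    with hf
  have h2 : ∫⁻ t in Ioi (0 : ℝ), φ ((√(‖x‖ ^ 2 + t))⁻¹ • x) * ENNReal.ofReal (normSqDensity F t) =
      ∫⁻ t in Ioi (0 : ℝ), f (‖x‖ ^ 2 + t) := by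
    refine lintegral_congr fun t => ?_
    simp only [hf, add_sub_cancel_left]
  rw [h2, lintegral_Ioi_comp_const_add f (‖x‖ ^ 2)]
  -- restrict from `Ioi 0` to `Ioi ‖x‖²` through the indicator
  have hsub : Ioi (‖x‖ ^ 2) = Ioi (‖x‖ ^ 2) ∩ Ioi (0 : ℝ) := by
    rw [Ioi_inter_Ioi, sup_eq_left.2 (sq_nonneg _)]
  rw [hsub, ← Measure.restrict_restrict measurableSet_Ioi,
    ← lintegral_indicator (measurableSet_Ioi : MeasurableSet (Ioi (‖x‖ ^ 2)))]
  refine lintegral_congr fun s => ?_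
  unfold sphereFibre
  by_cases hs : ‖x‖ ^ 2 < s
  · rw [indicator_of_mem (show s ∈ Ioi (‖x‖ ^ 2) from hs), if_pos hs]
  · rw [indicator_of_notMem (show s ∉ Ioi (‖x‖ ^ 2) from hs), if_neg hs]

/-- Auxiliary (proof-side) weight `W(s) = c_{E₁} κ_F (√s)^{dim E₁} s^{d/2-1} e^{-s/2}`
collecting, on the fibre `{‖(x,y)‖² = s}`, the two Gaussian normalisations, the `χ²` factor and
the Jacobian `(√s)^{dim E₁}` of the rescaling `x = √s · b`. [folklore] -/
def sphereWeight (s : ℝ) : ℝ :=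
  (2 * π) ^ (-(finrank ℝ E₁ : ℝ) / 2) * normSqConst F * (√s) ^ finrank ℝ E₁ *
    (s ^ ((finrank ℝ F : ℝ) / 2 - 1) * rexp (-s / 2))

omit [FiniteDimensional ℝ E₁] [MeasurableSpace E₁] [BorelSpace E₁] in
/-- The weight is measurable. [folklore] -/
theorem measurable_sphereWeight : Measurable (sphereWeight (E₁ := E₁) (F := F)) := by
  unfold sphereWeight
  refine ((measurable_const.mul ((continuous_sqrt.measurable).pow_const _)).mul
    ((Measurable.pow_const measurable_id _).mul ?_))
  fun_prop

omit [FiniteDimensional ℝ E₁] [MeasurableSpace E₁] [BorelSpace E₁] in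
/-- **Pointwise factorisation on a fibre.** For `s > 0` and `b = x/√s`:
`M_{E₁}(x) · 𝟙_{‖x‖² < s} ψ_F(s - ‖x‖²) = (c κ s^{d/2-1} e^{-s/2}) · (1 - ‖b‖²)^{d/2-1} 𝟙_{‖b‖<1}` —
the Gaussian weights `e^{-‖x‖²/2} e^{-(s-‖x‖²)/2}` combine to `e^{-s/2}` and
`s - ‖x‖² = s (1 - ‖b‖²)`. [folklore] -/
theorem gaussianDensity_mul_sphereFibre {φ : E₁ → ℝ≥0∞} {s : ℝ} (hs : 0 < s) (x : E₁) :
    ENNReal.ofReal ((2 * π) ^ (-(finrank ℝ E₁ : ℝ) / 2) * rexp (-‖x‖ ^ 2 / 2)) *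
        sphereFibre (F := F) φ x s =
      ENNReal.ofReal ((2 * π) ^ (-(finrank ℝ E₁ : ℝ) / 2) * normSqConst F *
          (s ^ ((finrank ℝ F : ℝ) / 2 - 1) * rexp (-s / 2))) *
        (φ ((√s)⁻¹ • x) *
          ENNReal.ofReal (sphereMarginalDensity (finrank ℝ F) ((√s)⁻¹ • x))) := by
  set a : ℝ := (finrank ℝ F : ℝ) / 2 - 1 with ha
  set c : ℝ := (2 * π) ^ (-(finrank ℝ E₁ : ℝ) / 2) with hc
  have hc0 : 0 < c := rpow_pos_of_pos (by positivity) _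
  have hsq : 0 < √s := Real.sqrt_pos.2 hs
  have hnb : ‖(√s)⁻¹ • x‖ = ‖x‖ / √s := by
    rw [norm_smul, norm_inv, Real.norm_of_nonneg hsq.le, div_eq_inv_mul]
  have hiff : ‖x‖ ^ 2 < s ↔ ‖(√s)⁻¹ • x‖ < 1 := by
    rw [hnb, div_lt_one hsq, Real.lt_sqrt (norm_nonneg _)]
  unfold sphereFibre sphereMarginalDensity
  by_cases hxs : ‖x‖ ^ 2 < s
  · have hb : ‖(√s)⁻¹ • x‖ < 1 := hiff.1 hxs
    rw [if_pos hxs, if_pos hb]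
    have hκ : 0 ≤ normSqConst F := normSqConst_nonneg
    have h1b : 0 ≤ 1 - ‖(√s)⁻¹ • x‖ ^ 2 := by nlinarith [norm_nonneg ((√s)⁻¹ • x)]
    have hsx : s - ‖x‖ ^ 2 = s * (1 - ‖(√s)⁻¹ • x‖ ^ 2) := by
      rw [hnb, div_pow, Real.sq_sqrt hs.le]
      field_simp
    -- the real identity behind the factorisation
    have key : (c * rexp (-‖x‖ ^ 2 / 2)) * normSqDensity F (s - ‖x‖ ^ 2) =
        c * normSqConst F * (s ^ a * rexp (-s / 2)) * (1 - ‖(√s)⁻¹ • x‖ ^ 2) ^ a := by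
      rw [normSqDensity, ← ha, hsx, Real.mul_rpow hs.le h1b]
      have hexp : rexp (-‖x‖ ^ 2 / 2) * rexp (-(s * (1 - ‖(√s)⁻¹ • x‖ ^ 2)) / 2) =
          rexp (-s / 2) := by
        rw [← Real.exp_add, ← hsx]
        congr 1; ring
      calc c * rexp (-‖x‖ ^ 2 / 2) *
            (normSqConst F * (s ^ a * (1 - ‖(√s)⁻¹ • x‖ ^ 2) ^ a *
              rexp (-(s * (1 - ‖(√s)⁻¹ • x‖ ^ 2)) / 2)))
          = c * normSqConst F * s ^ a * (1 - ‖(√s)⁻¹ • x‖ ^ 2) ^ a *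
              (rexp (-‖x‖ ^ 2 / 2) * rexp (-(s * (1 - ‖(√s)⁻¹ • x‖ ^ 2)) / 2)) := by ring
        _ = c * normSqConst F * (s ^ a * rexp (-s / 2)) * (1 - ‖(√s)⁻¹ • x‖ ^ 2) ^ a := by
              rw [hexp]; ring
    have hM0 : 0 ≤ c * rexp (-‖x‖ ^ 2 / 2) := by positivity
    calc ENNReal.ofReal (c * rexp (-‖x‖ ^ 2 / 2)) *
          (φ ((√s)⁻¹ • x) * ENNReal.ofReal (normSqDensity F (s - ‖x‖ ^ 2)))
        = φ ((√s)⁻¹ • x) * ENNReal.ofReal ((c * rexp (-‖x‖ ^ 2 / 2)) *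
            normSqDensity F (s - ‖x‖ ^ 2)) := by
          rw [ENNReal.ofReal_mul hM0]; ring
      _ = φ ((√s)⁻¹ • x) * (ENNReal.ofReal (c * normSqConst F * (s ^ a * rexp (-s / 2))) *
            ENNReal.ofReal ((1 - ‖(√s)⁻¹ • x‖ ^ 2) ^ a)) := by
          rw [key, ENNReal.ofReal_mul (by positivity)]
      _ = ENNReal.ofReal (c * normSqConst F * (s ^ a * rexp (-s / 2))) *
            (φ ((√s)⁻¹ • x) * ENNReal.ofReal ((1 - ‖(√s)⁻¹ • x‖ ^ 2) ^ a)) := by ring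
  · have hb : ¬ ‖(√s)⁻¹ • x‖ < 1 := fun h => hxs (hiff.2 h)
    rw [if_neg hxs, if_neg hb]
    simp

/-- **Fibre integral.** For `s > 0`, rescaling `x = √s · b` (`lintegral_comp_smul`):
`∫⁻ M_{E₁}(x) 𝟙_{‖x‖²<s} φ(x/√s) ψ_F(s - ‖x‖²) dx = W(s) ∫⁻ φ(b) σ(b) db`. [folklore] -/
theorem lintegral_gaussianDensity_mul_sphereFibre {φ : E₁ → ℝ≥0∞} (hφ : Measurable φ) {s : ℝ}
    (hs : 0 < s) :
    ∫⁻ x, ENNReal.ofReal ((2 * π) ^ (-(finrank ℝ E₁ : ℝ) / 2) * rexp (-‖x‖ ^ 2 / 2)) *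
        sphereFibre (F := F) φ x s =
      ENNReal.ofReal (sphereWeight (E₁ := E₁) (F := F) s) *
        ∫⁻ b, φ b * ENNReal.ofReal (sphereMarginalDensity (finrank ℝ F) b) := by
  have hsq : 0 < √s := Real.sqrt_pos.2 hs
  set C : ℝ≥0∞ := ENNReal.ofReal ((2 * π) ^ (-(finrank ℝ E₁ : ℝ) / 2) * normSqConst F *
    (s ^ ((finrank ℝ F : ℝ) / 2 - 1) * rexp (-s / 2))) with hC
  set h : E₁ → ℝ≥0∞ := fun b => C * (φ b * ENNReal.ofReal (sphereMarginalDensity (finrank ℝ F) b))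
    with hh
  have hpt : ∀ x, ENNReal.ofReal ((2 * π) ^ (-(finrank ℝ E₁ : ℝ) / 2) * rexp (-‖x‖ ^ 2 / 2)) *
      sphereFibre (F := F) φ x s = h ((√s)⁻¹ • x) := fun x =>
    gaussianDensity_mul_sphereFibre hs x
  simp_rw [hpt]
  have hm : Measurable fun b => φ b * ENNReal.ofReal (sphereMarginalDensity (finrank ℝ F) b) :=
    hφ.mul (ENNReal.measurable_ofReal.comp (measurable_sphereMarginalDensity _))
  have hint : ∫⁻ y, h y = C * ∫⁻ b, φ b * ENNReal.ofReal (sphereMarginalDensity (finrank ℝ F) b) :=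
    lintegral_const_mul C hm
  rw [lintegral_comp_smul h (inv_ne_zero hsq.ne'), hint, ← mul_assoc]
  congr 1
  rw [hC, inv_pow, inv_inv, abs_of_pos (pow_pos hsq _), ← ENNReal.ofReal_mul (pow_pos hsq _).le,
    sphereWeight]
  congr 1
  ring

/-- **Disintegration of the sphere-marginal law.** For measurable `φ ≥ 0`,
`∫⁻ φ(x/‖(x,y)‖) d(γ_{E₁} ⊗ γ_F)(x,y) = (∫⁻_{s>0} W(s) ds) · ∫⁻ φ(b) σ(b) db` — Tonelli in
`(x, y)`, the inner integral through `s = ‖x‖² + ‖y‖²` (`lintegral_sphereMarginalMap_fibre`),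
Tonelli again to integrate `x` first at fixed `s` (`lintegral_gaussianDensity_mul_sphereFibre`).
[folklore] -/
theorem lintegral_comp_sphereMarginalMap [Nontrivial F] {φ : E₁ → ℝ≥0∞} (hφ : Measurable φ) :
    ∫⁻ p, φ (sphereMarginalMap E₁ F p) ∂((stdGaussian E₁).prod (stdGaussian F)) =
      (∫⁻ s in Ioi (0 : ℝ), ENNReal.ofReal (sphereWeight (E₁ := E₁) (F := F) s)) *
        ∫⁻ b, φ b * ENNReal.ofReal (sphereMarginalDensity (finrank ℝ F) b) := by
  have hM : Measurable fun v : E₁ =>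
      ENNReal.ofReal ((2 * π) ^ (-(finrank ℝ E₁ : ℝ) / 2) * rexp (-‖v‖ ^ 2 / 2)) := by fun_prop
  have hJ : Measurable (Function.uncurry (sphereFibre (F := F) φ)) := measurable_sphereFibre hφ
  have hJx : ∀ x, Measurable fun s => sphereFibre (F := F) φ x s := fun x =>
    hJ.comp measurable_prodMk_left
  have hI : Measurable fun x : E₁ => ∫⁻ s in Ioi (0 : ℝ), sphereFibre (F := F) φ x s :=
    hJ.lintegral_prod_right'
  calc ∫⁻ p, φ (sphereMarginalMap E₁ F p) ∂((stdGaussian E₁).prod (stdGaussian F))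
      = ∫⁻ x, ∫⁻ y, φ (sphereMarginalMap E₁ F (x, y)) ∂(stdGaussian F) ∂(stdGaussian E₁) :=
        lintegral_prod _ (hφ.comp measurable_sphereMarginalMap).aemeasurable
    _ = ∫⁻ x, (∫⁻ s in Ioi (0 : ℝ), sphereFibre (F := F) φ x s) ∂(stdGaussian E₁) :=
        lintegral_congr fun x => lintegral_sphereMarginalMap_fibre hφ x
    _ = ∫⁻ x, ∫⁻ s in Ioi (0 : ℝ),
          ENNReal.ofReal ((2 * π) ^ (-(finrank ℝ E₁ : ℝ) / 2) * rexp (-‖x‖ ^ 2 / 2)) *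
            sphereFibre (F := F) φ x s := by
        rw [lintegral_stdGaussian_eq_lintegral_mul hI]
        refine lintegral_congr fun x => ?_
        rw [lintegral_const_mul _ (hJx x)]
    _ = ∫⁻ s in Ioi (0 : ℝ), ∫⁻ x,
          ENNReal.ofReal ((2 * π) ^ (-(finrank ℝ E₁ : ℝ) / 2) * rexp (-‖x‖ ^ 2 / 2)) *
            sphereFibre (F := F) φ x s := by
        refine lintegral_lintegral_swap ?_
        exact ((hM.comp measurable_fst).mul hJ).aemeasurable
    _ = ∫⁻ s in Ioi (0 : ℝ), ENNReal.ofReal (sphereWeight (E₁ := E₁) (F := F) s) *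
          ∫⁻ b, φ b * ENNReal.ofReal (sphereMarginalDensity (finrank ℝ F) b) :=
        setLIntegral_congr_fun measurableSet_Ioi fun s hs =>
          lintegral_gaussianDensity_mul_sphereFibre hφ hs
    _ = (∫⁻ s in Ioi (0 : ℝ), ENNReal.ofReal (sphereWeight (E₁ := E₁) (F := F) s)) *
          ∫⁻ b, φ b * ENNReal.ofReal (sphereMarginalDensity (finrank ℝ F) b) :=
        lintegral_mul_const _ (ENNReal.measurable_ofReal.comp measurable_sphereWeight)

/-- **The sphere marginal.** For independent standard Gaussian vectors `x ∈ E₁`, `y ∈ F`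
(`dim F = d ≥ 1`), the law of the `E₁`-block `x/√(‖x‖² + ‖y‖²)` of the unit vector
`(x, y)/‖(x, y)‖` — which is uniformly distributed on the unit sphere of `E₁ ⊕ F` — is
`K (1 - ‖b‖²)^{d/2-1} 𝟙_{‖b‖<1} db` for some constant `K > 0` (the value
`K = Γ((d₁+d)/2) / (π^{d₁/2} Γ(d/2))`, `d₁ = dim E₁`, is not asserted). The classical beta law
of a sub-vector of a uniform point on a sphere; for `E₁ = ℂ^p`, `F = ℂ^r` it is the law of `p`
entries of a column of a Haar unitary of size `p + r`, density `∝ (1 - ‖b‖²)^{r-1}`. [folklore] -/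
theorem map_sphereMarginalMap_prod_stdGaussian [Nontrivial F] :
    ∃ K : ℝ, 0 < K ∧
      ((stdGaussian E₁).prod (stdGaussian F)).map (sphereMarginalMap E₁ F) =
        volume.withDensity
          (fun b => ENNReal.ofReal (K * sphereMarginalDensity (finrank ℝ F) b)) := by
  set Ke : ℝ≥0∞ := ∫⁻ s in Ioi (0 : ℝ), ENNReal.ofReal (sphereWeight (E₁ := E₁) (F := F) s)
    with hKe
  set σ : E₁ → ℝ≥0∞ := fun b => ENNReal.ofReal (sphereMarginalDensity (finrank ℝ F) b) with hσ
  have hσm : Measurable σ := ENNReal.measurable_ofReal.comp (measurable_sphereMarginalDensity _)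
  set μ : Measure (E₁ × F) := (stdGaussian E₁).prod (stdGaussian F) with hμ
  have hmap : μ.map (sphereMarginalMap E₁ F) = Ke • volume.withDensity σ := by
    refine Measure.ext_of_lintegral _ fun φ hφ => ?_
    rw [lintegral_map hφ measurable_sphereMarginalMap, lintegral_comp_sphereMarginalMap hφ,
      lintegral_smul_measure, lintegral_withDensity_eq_lintegral_mul _ hσm hφ, smul_eq_mul]
    congr 1
    exact lintegral_congr fun b => mul_comm _ _
  -- total mass: `Ke * ∫ σ = 1`
  have hmass : Ke * ∫⁻ b, σ b = 1 := by
    have h := congrArg (fun ν : Measure E₁ => ν univ) hmap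
    simp only [Measure.smul_apply, withDensity_apply _ MeasurableSet.univ, Measure.restrict_univ,
      smul_eq_mul] at h
    rw [Measure.map_apply measurable_sphereMarginalMap MeasurableSet.univ, preimage_univ,
      measure_univ] at h
    exact h.symm
  have hK0 : Ke ≠ 0 := fun h0 => by simp [h0] at hmass
  have hKtop : Ke ≠ ⊤ := by
    intro htop
    rw [htop, ENNReal.top_mul'] at hmass
    split_ifs at hmass <;> simp at hmass
  refine ⟨Ke.toReal, ENNReal.toReal_pos hK0 hKtop, ?_⟩
  rw [hmap]
  have hfun : (fun b => ENNReal.ofReal (Ke.toReal * sphereMarginalDensity (finrank ℝ F) b)) =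
      Ke • σ := by
    funext b
    rw [Pi.smul_apply, smul_eq_mul, ENNReal.ofReal_mul ENNReal.toReal_nonneg,
      ENNReal.ofReal_toReal hKtop]
  rw [hfun, withDensity_smul _ hσm]

end SphereMarginal



end Literature.Probability.Distributions
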